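import Summits.Ventures.HodgeRepro2.T5LevelIdempotent

/-!
# `K₁ × K₂`-invariants of an external tensor product (Tier-5 kernel support, seat p8)

For representations `ρ₁` of `G₁` and `ρ₂` of `G₂`, Mathlib's `tprod` of `ρ₁ ∘ fst` and
`ρ₂ ∘ snd` is the external tensor product `ρ₁ ⊠ ρ₂` of `G₁ × G₂` on `V₁ ⊗ V₂` (written out,
no new definition).  For `K`-finite `ρ₁`, `ρ₂` in characteristic `0` (smooth representations,
compact open `K₁`, `K₂`) the `K₁ × K₂`-invariants are exactly the image of `V₁^{K₁} ⊗ V₂^{K₂}`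
(`invariants_prod_eq`), and `dim (V₁ ⊗ V₂)^{K₁ × K₂} = dim V₁^{K₁} · dim V₂^{K₂}`
(`finrank_invariants_prod`): the level idempotents act factorwise
(`map_levelIdempotent_id_of_forall`, `map_id_levelIdempotent_of_forall`).  This is the sentence
«(π₁ ⊠ π₂)^{K₁ × K₂} = π₁^{K₁} ⊗ π₂^{K₂}» behind the multiplicity bookkeeping of the record (two
factors; the restricted tensor product over all places stays prose).  Nothing is asserted about
any specific group.
-/

namespace Summit.Ventures.HodgeRepro2.T5LevelIdempotentTensor

open Summit.Ventures.HodgeRepro2.LevelPositivity Summit.Ventures.HodgeRepro2.T5LevelIdempotent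
open TensorProduct

variable {G₁ G₂ : Type*} [Group G₁] [Group G₂] {k : Type*} [Field k]
  {V₁ : Type*} [AddCommGroup V₁] [Module k V₁] {V₂ : Type*} [AddCommGroup V₂] [Module k V₂]
  (ρ₁ : Representation k G₁ V₁) (ρ₂ : Representation k G₂ V₂)

/-- `(Representation.tprod (MonoidHom.comp ρ₁ (MonoidHom.fst G₁ G₂))
      (MonoidHom.comp ρ₂ (MonoidHom.snd G₁ G₂))) (g₁, g₂) = ρ₁ g₁ ⊗ ρ₂ g₂`. -/
theorem extTprod_apply (g : G₁ × G₂) : (Representation.tprod (MonoidHom.comp ρ₁ (MonoidHom.fst G₁ G₂))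
      (MonoidHom.comp ρ₂ (MonoidHom.snd G₁ G₂))) g = map (ρ₁ g.1) (ρ₂ g.2) := by
  rw [Representation.tprod_apply]
  rfl

/-- `K₁ × K₂`-invariance is invariance under each factor. -/
theorem mem_invariants_prod_iff {K₁ : Subgroup G₁} {K₂ : Subgroup G₂} {x : V₁ ⊗[k] V₂} :
    x ∈ invariants (Representation.tprod (MonoidHom.comp ρ₁ (MonoidHom.fst G₁ G₂))
      (MonoidHom.comp ρ₂ (MonoidHom.snd G₁ G₂))) (K₁.prod K₂) ↔
      (∀ κ ∈ K₁, map (ρ₁ κ) LinearMap.id x = x) ∧ (∀ κ ∈ K₂, map LinearMap.id (ρ₂ κ) x = x) := by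
  rw [mem_invariants_iff]
  constructor
  · intro h
    refine ⟨fun κ hκ => ?_, fun κ hκ => ?_⟩
    · have := h (κ, 1) (Subgroup.mem_prod.2 ⟨hκ, K₂.one_mem⟩)
      rwa [extTprod_apply, map_one, Module.End.one_eq_id] at this
    · have := h (1, κ) (Subgroup.mem_prod.2 ⟨K₁.one_mem, hκ⟩)
      rwa [extTprod_apply, map_one, Module.End.one_eq_id] at this
  · rintro ⟨h₁, h₂⟩ ⟨κ₁, κ₂⟩ hκ
    rw [Subgroup.mem_prod] at hκ
    rw [extTprod_apply, ← LinearMap.comp_id (ρ₁ κ₁), ← LinearMap.id_comp (ρ₂ κ₂), map_comp,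
      LinearMap.comp_apply, h₂ κ₂ hκ.2, h₁ κ₁ hκ.1]

/-- A left-`K₁`-invariant tensor is fixed by `e_{K₁} ⊗ 1` (`K`-finite `ρ₁`, characteristic `0`). -/
theorem map_levelIdempotent_id_of_forall [CharZero k] {K₁ : Subgroup G₁} (hK₁ : KFinite ρ₁ K₁)
    {x : V₁ ⊗[k] V₂} (hx : ∀ κ ∈ K₁, map (ρ₁ κ) LinearMap.id x = x) :
    map (levelIdempotent K₁ hK₁) LinearMap.id x = x := by
  obtain ⟨S, rfl⟩ := TensorProduct.exists_finset x
  set H : Subgroup K₁ := ⨅ i ∈ S, stabilizerIn ρ₁ K₁ i.1 with hH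
  haveI : H.FiniteIndex := Subgroup.finiteIndex_iInf' _ (fun i _ => hK₁ i.1)
  have hle : ∀ i ∈ S, H ≤ stabilizerIn ρ₁ K₁ i.1 := fun i hi => iInf₂_le i hi
  have hk : (H.index : k) ≠ 0 := Nat.cast_ne_zero.2 Subgroup.FiniteIndex.index_ne_zero
  letI : Fintype (K₁ ⧸ H) := Fintype.ofFinite _
  rw [map_sum]
  simp only [map_tmul, LinearMap.id_apply, levelIdempotent_apply]
  calc ∑ i ∈ S, levelAverage ρ₁ K₁ i.1 ⊗ₜ[k] i.2
      = ∑ i ∈ S, (H.index : k)⁻¹ •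
          ∑ c : K₁ ⧸ H, ρ₁ ((Quotient.out c : K₁) : G₁) i.1 ⊗ₜ[k] i.2 := by
        refine Finset.sum_congr rfl (fun i hi => ?_)
        rw [levelAverage_eq (hle i hi) hk, ← smul_tmul']
        unfold cosetSum
        rw [finsum_eq_sum_of_fintype, sum_tmul]
    _ = (H.index : k)⁻¹ • ∑ c : K₁ ⧸ H,
          map (ρ₁ ((Quotient.out c : K₁) : G₁)) LinearMap.id (∑ i ∈ S, i.1 ⊗ₜ[k] i.2) := by
        rw [← Finset.smul_sum, Finset.sum_comm]
        congr 1
        refine Finset.sum_congr rfl (fun c _ => ?_)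
        rw [map_sum]
        simp only [map_tmul, LinearMap.id_apply]
    _ = (H.index : k)⁻¹ • ∑ _c : K₁ ⧸ H, ∑ i ∈ S, i.1 ⊗ₜ[k] i.2 := by
        congr 1
        exact Finset.sum_congr rfl (fun c _ => hx _ (Quotient.out c).2)
    _ = ∑ i ∈ S, i.1 ⊗ₜ[k] i.2 := by
        rw [Finset.sum_const, Finset.card_univ, ← Nat.cast_smul_eq_nsmul k,
          ← Nat.card_eq_fintype_card, ← Subgroup.index_eq_card, smul_smul, inv_mul_cancel₀ hk,
          one_smul]

/-- A right-`K₂`-invariant tensor is fixed by `1 ⊗ e_{K₂}` (`K`-finite `ρ₂`, characteristic `0`). -/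
theorem map_id_levelIdempotent_of_forall [CharZero k] {K₂ : Subgroup G₂} (hK₂ : KFinite ρ₂ K₂)
    {x : V₁ ⊗[k] V₂} (hx : ∀ κ ∈ K₂, map LinearMap.id (ρ₂ κ) x = x) :
    map LinearMap.id (levelIdempotent K₂ hK₂) x = x := by
  obtain ⟨S, rfl⟩ := TensorProduct.exists_finset x
  set H : Subgroup K₂ := ⨅ i ∈ S, stabilizerIn ρ₂ K₂ i.2 with hH
  haveI : H.FiniteIndex := Subgroup.finiteIndex_iInf' _ (fun i _ => hK₂ i.2)
  have hle : ∀ i ∈ S, H ≤ stabilizerIn ρ₂ K₂ i.2 := fun i hi => iInf₂_le i hi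
  have hk : (H.index : k) ≠ 0 := Nat.cast_ne_zero.2 Subgroup.FiniteIndex.index_ne_zero
  letI : Fintype (K₂ ⧸ H) := Fintype.ofFinite _
  rw [map_sum]
  simp only [map_tmul, LinearMap.id_apply, levelIdempotent_apply]
  calc ∑ i ∈ S, i.1 ⊗ₜ[k] levelAverage ρ₂ K₂ i.2
      = ∑ i ∈ S, (H.index : k)⁻¹ •
          ∑ c : K₂ ⧸ H, i.1 ⊗ₜ[k] ρ₂ ((Quotient.out c : K₂) : G₂) i.2 := by
        refine Finset.sum_congr rfl (fun i hi => ?_)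
        rw [levelAverage_eq (hle i hi) hk, tmul_smul]
        unfold cosetSum
        rw [finsum_eq_sum_of_fintype, tmul_sum]
    _ = (H.index : k)⁻¹ • ∑ c : K₂ ⧸ H,
          map LinearMap.id (ρ₂ ((Quotient.out c : K₂) : G₂)) (∑ i ∈ S, i.1 ⊗ₜ[k] i.2) := by
        rw [← Finset.smul_sum, Finset.sum_comm]
        congr 1
        refine Finset.sum_congr rfl (fun c _ => ?_)
        rw [map_sum]
        simp only [map_tmul, LinearMap.id_apply]
    _ = (H.index : k)⁻¹ • ∑ _c : K₂ ⧸ H, ∑ i ∈ S, i.1 ⊗ₜ[k] i.2 := by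
        congr 1
        exact Finset.sum_congr rfl (fun c _ => hx _ (Quotient.out c).2)
    _ = ∑ i ∈ S, i.1 ⊗ₜ[k] i.2 := by
        rw [Finset.sum_const, Finset.card_univ, ← Nat.cast_smul_eq_nsmul k,
          ← Nat.card_eq_fintype_card, ← Subgroup.index_eq_card, smul_smul, inv_mul_cancel₀ hk,
          one_smul]

/-- `(V₁ ⊗ V₂)^{K₁ × K₂}` is the image of `V₁^{K₁} ⊗ V₂^{K₂}`
(`K`-finite `ρ₁`, `ρ₂`, characteristic `0`). -/
theorem invariants_prod_eq [CharZero k] {K₁ : Subgroup G₁} {K₂ : Subgroup G₂}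
    (hK₁ : KFinite ρ₁ K₁) (hK₂ : KFinite ρ₂ K₂) :
    invariants (Representation.tprod (MonoidHom.comp ρ₁ (MonoidHom.fst G₁ G₂))
      (MonoidHom.comp ρ₂ (MonoidHom.snd G₁ G₂))) (K₁.prod K₂) =
      LinearMap.range (mapIncl (invariants ρ₁ K₁) (invariants ρ₂ K₂)) := by
  apply le_antisymm
  · intro x hx
    obtain ⟨h₁, h₂⟩ := (mem_invariants_prod_iff ρ₁ ρ₂).1 hx
    have hx' : x = map (levelIdempotent K₁ hK₁) (levelIdempotent K₂ hK₂) x := by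
      conv_lhs => rw [← map_levelIdempotent_id_of_forall ρ₁ hK₁ h₁,
        ← map_id_levelIdempotent_of_forall ρ₂ hK₂ h₂]
      rw [← LinearMap.comp_apply, ← map_comp, LinearMap.comp_id, LinearMap.id_comp]
    rw [hx', range_mapIncl, ← range_levelIdempotent ρ₁ K₁ hK₁, ← range_levelIdempotent ρ₂ K₂ hK₂,
      ← range_map]
    exact LinearMap.mem_range_self _ x
  · rw [range_mapIncl]
    apply Submodule.map₂_le.2
    intro v hv w hw
    rw [mem_invariants_prod_iff]
    refine ⟨fun κ hκ => ?_, fun κ hκ => ?_⟩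
    · rw [mk_apply, map_tmul, LinearMap.id_apply, mem_invariants_iff.1 hv κ hκ]
    · rw [mk_apply, map_tmul, LinearMap.id_apply, mem_invariants_iff.1 hw κ hκ]

/-- `V₁^{K₁} ⊗ V₂^{K₂} → V₁ ⊗ V₂` is injective (vector spaces are flat). -/
theorem mapIncl_injective (K₁ : Subgroup G₁) (K₂ : Subgroup G₂) :
    Function.Injective (mapIncl (invariants ρ₁ K₁) (invariants ρ₂ K₂)) :=
  map_injective_of_flat_flat _ _ (Submodule.subtype_injective _) (Submodule.subtype_injective _)

/-- `dim (V₁ ⊗ V₂)^{K₁ × K₂} = dim V₁^{K₁} · dim V₂^{K₂}`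
(`K`-finite `ρ₁`, `ρ₂`, characteristic `0`, finite-dimensional invariants). -/
theorem finrank_invariants_prod [CharZero k] {K₁ : Subgroup G₁} {K₂ : Subgroup G₂}
    (hK₁ : KFinite ρ₁ K₁) (hK₂ : KFinite ρ₂ K₂) [FiniteDimensional k (invariants ρ₁ K₁)]
    [FiniteDimensional k (invariants ρ₂ K₂)] :
    Module.finrank k (invariants (Representation.tprod (MonoidHom.comp ρ₁ (MonoidHom.fst G₁ G₂))
      (MonoidHom.comp ρ₂ (MonoidHom.snd G₁ G₂))) (K₁.prod K₂)) =
      Module.finrank k (invariants ρ₁ K₁) * Module.finrank k (invariants ρ₂ K₂) := by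
  rw [invariants_prod_eq ρ₁ ρ₂ hK₁ hK₂, LinearMap.finrank_range_of_inj (mapIncl_injective ρ₁ ρ₂ K₁ K₂),
    Module.finrank_tensorProduct]

/-- The `K₁ × K₂`-invariants of the external tensor product are finite-dimensional when both
factors' invariants are (`K`-finite `ρ₁`, `ρ₂`, characteristic `0`). -/
theorem finiteDimensional_invariants_prod [CharZero k] {K₁ : Subgroup G₁} {K₂ : Subgroup G₂}
    (hK₁ : KFinite ρ₁ K₁) (hK₂ : KFinite ρ₂ K₂) [FiniteDimensional k (invariants ρ₁ K₁)]
    [FiniteDimensional k (invariants ρ₂ K₂)] :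
    FiniteDimensional k (invariants (Representation.tprod (MonoidHom.comp ρ₁ (MonoidHom.fst G₁ G₂))
      (MonoidHom.comp ρ₂ (MonoidHom.snd G₁ G₂))) (K₁.prod K₂)) := by
  rw [invariants_prod_eq ρ₁ ρ₂ hK₁ hK₂]
  infer_instance

end Summit.Ventures.HodgeRepro2.T5LevelIdempotentTensor
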